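import Summits.QuantumFields.BalabanUV.T4Continuum.Spine.NE1p.DressedSourceAnalyticSlotLetters

/-!
# T⁴ programme, spine estimate NE1′ (node O3b/H2) — S46's FOUR ENDs READ AT THE ACTIVITY SLOT OF RECORD `(slotsOfRecord …).act`:
# row NE5's `TermLineAnalytic`, the SOURCE-ANALYTIC, RESPONSE and JOINT ENDs of the substrate's slot activities at the Gaussian
# letters of record, with the activities written LITERALLY as the (2.14) activity slot of MAP §O1 O-8 (`slotsOfRecord_act`, `rfl`) —
# S30 §3's pattern VERBATIM for S46 (operator space `OpDatum (SpeciesRec D o T ι′ Ω 𝒴)`, factor letters `L.A` of slot letters `L`)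

Cell `pub-balaban`, sub-cell `t4`, BINDER-OWNERS row NE1′ (owner lineage t4-ne1p-p1); NE1′ formalisation crew, unit
`b2b-balaban-t4-ne1p-formalise-leaf-07` (LEAF PROVER 07, generation 17); crew row S⟨next⟩ of `t4/formal/NE1p/LEAVES.md`, PART 2 of 2
(PART 1 `Spine/NE1p/DressedSourceAnalyticSlotLettersTorus` puts S46 on pv22's torus; INTENT `CLAIMS.log` 2026-08-20 — S46's holder
leaf-03-g13 NAMED both followers at its SEAT-CLOSING l.21119 «S46 at `(slotsOfRecord …).act` (S30 §3 pattern), S46 on the torus (S31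
pattern) … NOT started (none owed)», and S46's own header l.38 «S30 §3's reading at `(slotsOfRecord …).act` … applies verbatim to all
four and is left to a follower»; this seat READ S46 as X177, l.21152).  ADDITIVE — imports crew row S46
`Spine/NE1p/DressedSourceAnalyticSlotLetters` ONLY (leaf-03-g13, p235653; → S42 → S33 → N0r …; → S30 `DressedSmallFieldOnCoresSlotLetters` →
the SUBSTRATE cell's `Support/SubstrateSlotsOfRecord` (`SlotLetters`, `slotsOfRecord`, `slotsOfRecord_act`, `SpeciesRec`) ∕
`SubstrateGaussianLettersBall` ∕ `SubstrateActivities`; row NE5's `B13OpDatum` (`OpDatum`) ∕ `B13StepTermLabels` (`InnerLabel`) ∕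
`B13InnerData` (`Bnd`)); THEOREMS ONLY (0 `def`, 0 `def … : Prop`, 0 cite, 0 `example`); nothing of S46 ∕ S30 ∕ S33 ∕ S42 ∕ N0m–N0r ∕ the
substrate ∕ row NE5 is restated — their declarations are used BY NAME.

WHY THIS FILE.  S30 §3 read N0r's attached-part ∕ μ-part ENDs at the substrate's CORE LETTERS OF RECORD once more with the activities
written LITERALLY as the (2.14) ACTIVITY SLOT OF RECORD `(slotsOfRecord D ι c a s P 𝒵 dom Jc V mI L).act p.1 p.2 op h` of MAP §O1 O-8
(`Op := OpDatum (SpeciesRec D o T ι′ Ω 𝒴)`, `A := L.A` for slot letters `L : SlotLetters …`; `slotsOfRecord_act` is `rfl`).  S46 re-socketed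
the unit's three analytic ENDs (S33 §4 ×2, S42 §5) and row NE5's `TermLineAnalytic` (S42 §2) at `coreLettersOf A` but, as its header says,
left the `(slotsOfRecord …).act` reading «to a follower».  THIS FILE is that follower — S30 §3's two-line proof pattern (`rw
[slotsOfRecord_act]; exact …`) applied to S46's four theorems, nothing else:
* §1 **`termLineAnalytic_slotsOfRecord_act`** — S46 §1 ONCE BY NAME: row NE5's displayed binder shape `hline : TermLineAnalytic (ballClass
  ctr ROp RHist) T W` for `T := fun _ p op h _ => (slotsOfRecord …).act p.1 p.2 op h` — THE ACTIVITY SLOT OF RECORD ITSELF — from the room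
  + S30 §1's eleven per-factor scalar conditions on the slot letters' Gaussian tables `(L.A Z j).base` ∕ `.rd` ONLY;
* §2 **`analytic_and_bounded_locE_slotsOfRecord_act`** ∕ **`muDeriv_locE_le_slotsOfRecord_act`** — S46 §2 ONCE each BY NAME: holomorphy
  in the source + the μ-uniform (2.41) envelope, and the linear response, of the dressed output `σ ↦ E[Σ_{p ∈ terms Z} (slotsOfRecord
  …).act p.1 p.2 op (h₀ + σ • v)](X₀)`;
* §3 **`analytic_and_bounded_locE_opSource_slotsOfRecord_act`** — S46 §3 ONCE BY NAME: joint holomorphy in (operator datum, source) on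
  `ball (ctr k g U).1 (ROp k) ×ˢ ball 0 μ₁` + the envelope.
Binders LITERALLY S46's at `Op := OpDatum (SpeciesRec …)`, `A := L.A` (the contour parameter is written `a′`, the operator datum `op`, the
source variable `σ` — `a`, `o`, `s` being the slots-of-record letters `a : ℝ`, `o` the colour index type, `s : ℕ → ℂ`, exactly as in S30
§3); conclusions LITERALLY S46's with `actOfLetters … (coreLettersOf … L.A) p.1 p.2` REPLACED by `(slotsOfRecord …).act p.1 p.2`.  The
class centre `ctr` stays GENERAL: its identification with run B's operator datum of record `opOf (slotsOfRecord …).F (slotsOfRecord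
…).rawB g U k` (where row NE5's END of record places the centre conditions) and with NE1′'s window classes is the substrate's ∕ the
owner's READING — NOT asserted (S30 §3's sentence, verbatim in substance).  CENSUS vs S46 §1∕§2∕§3 (binders, by name): MINUS = [`Op`
(specialised), `A` (↦ `L.A`)]; PLUS = [the slots-of-record letters `ι`, `c`, `a`, `s`, `L` and their index types]; `o ↦ op`; rest IDENTICAL.

WHAT THIS DOES TO THE WALL (reading offered to the owner ∕ dagwriter ∕ NE5's typer; nothing re-labelled here).  For the substrate's
activity slot OF RECORD — the object NE5's functional of record `outB_KP (slotsOfRecord …)` is built from — row NE5's displayed `hline`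
and NE1′'s source-analytic ∕ response ∕ joint small-field ENDs are KERNEL from the room, finitely many scalar per-factor conditions on
the slot letters' displayed Gaussian tables at the class centres, the class radii, (B1b)'s residue `terms` ∕ `emb` ∕ `hscale`, the clause
SHAPES and (B3) `hM3` on S30's EXPLICIT letters — ALL DISPLAYED.  Which tables realise Bałaban's `C^{(k)}(Z₀,σ)`, `Γ_k` of
[Balaban1988RGII] (2.14) p. 15 and WHETHER the datum of record meets the centre conditions is the SUBSTRATE's displayed identification,
NOT claimed; row NE5's wall line «`TermLineAnalytic` of the (2.14)-terms» concerns Bałaban's resummed terms — for the slot of record it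
is kernel MODULO the displayed scalar conditions, for Bałaban's terms NOT claimed; (B3) = G-ne9p2-5 UNPRINTED (shared with NE9); 0
binders instantiated on Bałaban's densities; no numeral of print; no new inequality; no wall item of NE1′ or NE5 moves; the wall
wording of record (v1.8, T4-DAG v48 §8 Q47 (b): words, not kind) does NOT move; R-t4r2-Q2 NOT met thereby; NE1′ NOT printed ∕ proved; 0∕9.

HONEST FRAMING.  By-name kernel plumbing — one `rw [slotsOfRecord_act]` and one application of S46 per theorem ([folklore]); 0
estimates of print; printed loci are TYPE ∕ CONTEXT through the imported modules, re-asserted nowhere; ABSOLUTE RULE honoured.  Rung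
(B)+1 on ONE finite four-torus — NOT infinite volume, NOT a mass gap, NOT OS on ℝ⁴, NOT Clay.  HONEST DEPENDENCY: continuum YM on T⁴ ⇐
BetaPertH ∧ nine spine estimates (0/9 proved); BetaPertH ⇐ (D1) ∧ (D4) ∧ CAP+tail; G-an2-4 gates asym, D1 and NE2/3/4. -/

noncomputable section

namespace Summit.QuantumFields.BalabanUV.T4Continuum.NE1p.DressedSourceAnalyticSlotsOfRecord

open scoped BigOperators Matrix
open Metric Set MeasureTheory
open Literature.MathematicalPhysics.QuantumFieldTheory.Balaban1983to89
open Literature.MathematicalPhysics.QuantumFieldTheory.Balaban1983to89.B13Resummation (locE Geometry)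
open Literature.MathematicalPhysics.QuantumFieldTheory.Balaban1983to89.B5Prop11Lower (nsq)
open Literature.MathematicalPhysics.QuantumFieldTheory.Balaban1983to89.T4InputCauchyRateSpecies (ballClass)
open Literature.MathematicalPhysics.QuantumFieldTheory.Balaban1983to89.T4InputCauchyRateTermwise (TermLineAnalytic)
open Summit.QuantumFields.BalabanUV.T4Continuum.B13OpDatum (OpDatum)
open Summit.QuantumFields.BalabanUV.T4Continuum.B13HistMeasurable (MeasPotFrame B13HistM)
open Summit.QuantumFields.BalabanUV.T4Continuum.B13StepTermLabels (InnerLabel)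
open Summit.QuantumFields.BalabanUV.T4Continuum.B13InnerData (Bnd)
open Summit.QuantumFields.BalabanUV.T4Continuum.SubstrateTwoRunsDriven (DrivenRuns)
open Summit.QuantumFields.BalabanUV.T4Continuum.SubstrateActivities (coreOf actOfLetters)
open Summit.QuantumFields.BalabanUV.T4Continuum.SubstrateGaussianLetters (gaussC linForm)
open Summit.QuantumFields.BalabanUV.T4Continuum.SubstrateGaussianLettersBall (detBudget)
open Summit.QuantumFields.BalabanUV.T4Continuum.SubstrateSlotsOfRecord (ActLetters coreLettersOf SpeciesRec SlotLetters slotsOfRecord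
  slotsOfRecord_act)
open Summit.QuantumFields.BalabanUV.T4Continuum.NE1p.DressedSourceAnalyticSlotLetters (termLineAnalytic_coreLettersOf
  analytic_and_bounded_locE_of_coreLettersOf muDeriv_locE_le_of_coreLettersOf analytic_and_bounded_locE_opSource_of_coreLettersOf)

variable {G : Type} [GaugeGroup G] (D : DrivenRuns G) (P : MeasPotFrame D.carriers)

section SlotsOfRecord

variable {o : Type} [Fintype o] [DecidableEq o] (ι : G →* Matrix o o ℂ) (c : ℂ) (a : ℝ) (s : ℕ → ℂ)
variable {T ι' S Ω 𝒴 : Type} {IOp : Type*}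
  (𝒵 : D.carriers.Dom → InnerLabel D.carriers.Dom (Bnd D.toTwoRuns) → Type) [∀ Z j, Fintype (𝒵 Z j)]
  (dom : ∀ Z j, 𝒵 Z j → D.carriers.Dom)
  (Jc : D.carriers.Dom → InnerLabel D.carriers.Dom (Bnd D.toTwoRuns) → Type) [∀ Z j, Fintype (Jc Z j)]
  (V : D.carriers.Dom → InnerLabel D.carriers.Dom (Bnd D.toTwoRuns) → Type) [∀ Z j, NormedAddCommGroup (V Z j)]
  [∀ Z j, InnerProductSpace ℝ (V Z j)] [∀ Z j, MeasurableSpace (V Z j)] [∀ Z j, BorelSpace (V Z j)] [∀ Z j, FiniteDimensional ℝ (V Z j)]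
  (mI : D.carriers.Dom → InnerLabel D.carriers.Dom (Bnd D.toTwoRuns) → Type) [∀ Z j, Fintype (mI Z j)] [∀ Z j, DecidableEq (mI Z j)]
  (L : SlotLetters D (o := o) (T := T) (ι' := ι') (S := S) (Ω := Ω) (𝒴 := 𝒴) P (IOp := IOp) 𝒵 dom Jc V mI)

/-! ## §1 Row NE5's `TermLineAnalytic` FOR THE ACTIVITY SLOT OF RECORD ITSELF -/

/-- **ROW NE5's `TermLineAnalytic` HOLDS FOR THE (2.14) ACTIVITY SLOT OF RECORD `(slotsOfRecord …).act`** (kernel; S46 §1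
`termLineAnalytic_coreLettersOf` ONCE BY NAME at `Op := OpDatum (SpeciesRec D o T ι′ Ω 𝒴)`, `A := L.A`, the term family written LITERALLY as
`fun _ p op h _ => (slotsOfRecord D ι c a s P 𝒵 dom Jc V mI L).act p.1 p.2 op h` — `slotsOfRecord_act`, `rfl`).  Binders = S46 §1's: the room,
`0 ≤ R′ k`, and S30 §1's per-factor scalar letter conditions on the slot letters' Gaussian tables `(L.A Z j).base` ∕ `.rd` (`hbase` ∕ `hrdm`
∕ `hβ₀` ∕ `hd₀` ∕ `hrd`, the CENTRE CONDITIONS `hctr`, the radius smallnesses `hbud` ∕ `hmq`) ONLY — no table, no geometry, no (B3).  The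
class centre `ctr` is GENERAL (its identification with run B's operator datum of record is the substrate's ∕ owner's READING, NOT asserted).
[folklore] -/
theorem termLineAnalytic_slotsOfRecord_act {W : Set (ℕ → ℝ)}
    {ctr : ℕ → (ℕ → ℝ) → D.carriers.BgB → OpDatum (SpeciesRec D o T ι' Ω 𝒴) × B13HistM P} {ROp RHist R' : ℕ → ℝ}
    {β₀ ϑ d₀ γ : D.carriers.Dom → InnerLabel D.carriers.Dom (Bnd D.toTwoRuns) → ℝ}
    (hroom : ∀ k, ROp k < R' k) (hR' : ∀ k, 0 ≤ R' k)
    (hbase : ∀ Z j ii jj, Measurable fun a' => (L.A Z j).base a' ii jj)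
    (hrdm : ∀ Z j ii jj (o' : OpDatum (SpeciesRec D o T ι' Ω 𝒴)), Measurable fun a' => (L.A Z j).rd a' ii jj o')
    (hβ₀ : ∀ Z j, 0 ≤ β₀ Z j) (hd₀ : ∀ Z j, 0 < d₀ Z j)
    (hrd : ∀ Z j a' ii jj, ‖(L.A Z j).rd a' ii jj‖ ≤ ϑ Z j)
    (hctr : ∀ k, ∀ g ∈ W, ∀ (U : D.carriers.BgB) (Z : D.carriers.Dom) (j : InnerLabel D.carriers.Dom (Bnd D.toTwoRuns))
      (a' : (Jc Z j ⊕ 𝒵 Z j) → ℝ × ℝ),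
      (∀ ii jj, ‖linForm (L.A Z j).base (L.A Z j).rd (ctr k g U).1 a' ii jj‖ ≤ β₀ Z j) ∧
      ((linForm (L.A Z j).base (L.A Z j).rd (ctr k g U).1 a').det).im = 0 ∧ d₀ Z j ≤ ((linForm (L.A Z j).base (L.A Z j).rd (ctr k g U).1 a').det).re ∧
      (∀ x : mI Z j → ℂ, γ Z j * nsq x ≤ (star x ⬝ᵥ (linForm (L.A Z j).base (L.A Z j).rd (ctr k g U).1 a' *ᵥ x)).re))
    (hbud : ∀ k Z j, detBudget (Fintype.card (mI Z j)) (β₀ Z j) (ϑ Z j) (R' k) < d₀ Z j)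
    (hmq : ∀ k Z j, Fintype.card (mI Z j) * ϑ Z j * R' k < γ Z j) :
    TermLineAnalytic (ballClass ctr ROp RHist)
      (fun (_ : ℕ) (p : D.carriers.Dom × InnerLabel D.carriers.Dom (Bnd D.toTwoRuns)) (op : OpDatum (SpeciesRec D o T ι' Ω 𝒴)) (h : B13HistM P)
        (_ : D.carriers.Dom) => (slotsOfRecord D ι c a s P 𝒵 dom Jc V mI L).act p.1 p.2 op h) W := by
  rw [slotsOfRecord_act]
  exact termLineAnalytic_coreLettersOf D P (OpDatum (SpeciesRec D o T ι' Ω 𝒴)) 𝒵 dom Jc V mI L.A hroom hR' hbase hrdm hβ₀ hd₀ hrd hctr hbud hmq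

/-! ## §2 THE SOURCE-ANALYTIC AND RESPONSE ENDs AT THE ACTIVITY SLOT OF RECORD -/

variable (𝔇 : LocDomainSys) {Cube : Type} [DecidableEq Cube] (Ge : Geometry 𝔇 Cube)

open Classical in
/-- **HOLOMORPHY IN THE SOURCE + THE μ-UNIFORM (2.41) ENVELOPE OF THE DRESSED OUTPUT OF THE ACTIVITY SLOT OF RECORD** (kernel; S46 §2
`analytic_and_bounded_locE_of_coreLettersOf` ONCE BY NAME at `Op := OpDatum (SpeciesRec …)`, `A := L.A`, activities LITERALLY `(slotsOfRecord
…).act p.1 p.2 op h`).  Binders = S46 §2's (room, `0 ≤ R′`, S30 §1's scalar conditions, class radii `hO` ∕ `hH` at the source radius `μ₁`,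
`hscale`, `terms`, the clauses, (B3) `hM3` on S30's EXPLICIT letters); conclusion LITERALLY S46 §2's for the slot of record: `σ ↦ E[Σ_{p ∈ terms Z}
(slotsOfRecord …).act p.1 p.2 op (h₀ + σ • v)](X₀)` is complex differentiable on `‖σ‖ < μ₁` and bounded there by `e·ν·c₁·K₀²·A′·e^{−r₁ d(X₀)}`.
[folklore] -/
theorem analytic_and_bounded_locE_slotsOfRecord_act {W : Set (ℕ → ℝ)}
    {ctr : ℕ → (ℕ → ℝ) → D.carriers.BgB → OpDatum (SpeciesRec D o T ι' Ω 𝒴) × B13HistM P} {ROp RHist R' : ℕ → ℝ}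
    {β₀ ϑ d₀ γ : D.carriers.Dom → InnerLabel D.carriers.Dom (Bnd D.toTwoRuns) → ℝ}
    (hroom : ∀ k, ROp k < R' k) (hR' : ∀ k, 0 ≤ R' k)
    (hbase : ∀ Z j ii jj, Measurable fun a' => (L.A Z j).base a' ii jj)
    (hrdm : ∀ Z j ii jj (o' : OpDatum (SpeciesRec D o T ι' Ω 𝒴)), Measurable fun a' => (L.A Z j).rd a' ii jj o')
    (hβ₀ : ∀ Z j, 0 ≤ β₀ Z j) (hd₀ : ∀ Z j, 0 < d₀ Z j)
    (hrd : ∀ Z j a' ii jj, ‖(L.A Z j).rd a' ii jj‖ ≤ ϑ Z j)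
    (hctr : ∀ k, ∀ g ∈ W, ∀ (U : D.carriers.BgB) (Z : D.carriers.Dom) (j : InnerLabel D.carriers.Dom (Bnd D.toTwoRuns))
      (a' : (Jc Z j ⊕ 𝒵 Z j) → ℝ × ℝ),
      (∀ ii jj, ‖linForm (L.A Z j).base (L.A Z j).rd (ctr k g U).1 a' ii jj‖ ≤ β₀ Z j) ∧
      ((linForm (L.A Z j).base (L.A Z j).rd (ctr k g U).1 a').det).im = 0 ∧ d₀ Z j ≤ ((linForm (L.A Z j).base (L.A Z j).rd (ctr k g U).1 a').det).re ∧
      (∀ x : mI Z j → ℂ, γ Z j * nsq x ≤ (star x ⬝ᵥ (linForm (L.A Z j).base (L.A Z j).rd (ctr k g U).1 a' *ᵥ x)).re))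
    (hbud : ∀ k Z j, detBudget (Fintype.card (mI Z j)) (β₀ Z j) (ϑ Z j) (R' k) < d₀ Z j)
    (hmq : ∀ k Z j, Fintype.card (mI Z j) * ϑ Z j * R' k < γ Z j)
    {k : ℕ} {g : ℕ → ℝ} (hg : g ∈ W) {U : D.carriers.BgB} {op : OpDatum (SpeciesRec D o T ι' Ω 𝒴)} {h₀ v : B13HistM P} {μ₁ : ℝ}
    (hO : ‖op - (ctr k g U).1‖ ≤ ROp k) (hH : ‖h₀ - (ctr k g U).2‖ + μ₁ * ‖v‖ ≤ RHist k)
    {emb : 𝔇.Dom → D.carriers.Dom} (hscale : ∀ Z, D.carriers.scale (emb Z) = k)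
    (terms : 𝔇.Dom → Finset (D.carriers.Dom × InnerLabel D.carriers.Dom (Bnd D.toTwoRuns)))
    {A' R r₁ b₅ : ℝ} {X₀ : 𝔇.Dom} (hA : 0 ≤ A') (hr₁ : 0 ≤ r₁) (hb : r₁ * 5 ≤ b₅)
    (hrate : r₁ + 2 * Ge.κ₀ + 2 ≤ R) (hsmall : A' * Real.exp (b₅ + 1) * Ge.K₀ * Ge.ν * Ge.c₁ ≤ 1)
    (hM3 : ∀ Z, Ge.cubes Z ⊆ Ge.cubes X₀ →
      ∑ p ∈ terms Z, (coreOf P (OpDatum (SpeciesRec D o T ι' Ω 𝒴)) 𝒵 dom Jc V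
            (coreLettersOf D P (OpDatum (SpeciesRec D o T ι' Ω 𝒴)) 𝒵 dom Jc V mI L.A) p.1 p.2).lam.real univ *
          ((coreOf P (OpDatum (SpeciesRec D o T ι' Ω 𝒴)) 𝒵 dom Jc V
            (coreLettersOf D P (OpDatum (SpeciesRec D o T ι' Ω 𝒴)) 𝒵 dom Jc V mI L.A) p.1 p.2).wB *
              (gaussC (mI p.1 p.2) * Real.sqrt (max 1 ((Fintype.card (mI p.1 p.2)).factorial *
                β₀ p.1 p.2 ^ Fintype.card (mI p.1 p.2) + d₀ p.1 p.2))) * Real.exp 0) *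
          (Real.pi / ((γ p.1 p.2 - Fintype.card (mI p.1 p.2) * ϑ p.1 p.2 * R' k) / 2 / 2)) ^ (Module.finrank ℝ (V p.1 p.2) / 2 : ℝ) *
        Real.exp ((coreOf P (OpDatum (SpeciesRec D o T ι' Ω 𝒴)) 𝒵 dom Jc V
            (coreLettersOf D P (OpDatum (SpeciesRec D o T ι' Ω 𝒴)) 𝒵 dom Jc V mI L.A) p.1 p.2).N₁ * (‖h₀‖ + μ₁ * ‖v‖)) ≤
        A' * Real.exp (-(R * 𝔇.dj Z))) :
    DifferentiableOn ℂ (fun σ => locE Ge.ι Ge.cubes (fun Z => ∑ p ∈ terms Z, (slotsOfRecord D ι c a s P 𝒵 dom Jc V mI L).act p.1 p.2 op (h₀ + σ • v))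
        (Ge.cubes X₀)) (ball (0 : ℂ) μ₁) ∧
      ∀ σ ∈ ball (0 : ℂ) μ₁, ‖locE Ge.ι Ge.cubes (fun Z => ∑ p ∈ terms Z, (slotsOfRecord D ι c a s P 𝒵 dom Jc V mI L).act p.1 p.2 op (h₀ + σ • v))
          (Ge.cubes X₀)‖ ≤ Real.exp 1 * Ge.ν * Ge.c₁ * Ge.K₀ ^ 2 * A' * Real.exp (-(r₁ * 𝔇.dj X₀)) := by
  rw [slotsOfRecord_act]
  exact analytic_and_bounded_locE_of_coreLettersOf D P (OpDatum (SpeciesRec D o T ι' Ω 𝒴)) 𝒵 dom Jc V mI 𝔇 Ge L.A hroom hR' hbase hrdm hβ₀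
    hd₀ hrd hctr hbud hmq hg hO hH hscale terms hA hr₁ hb hrate hsmall hM3

open Classical in
/-- **LINEAR RESPONSE OF THE DRESSED OUTPUT OF THE ACTIVITY SLOT OF RECORD** (kernel; S46 §2 `muDeriv_locE_le_of_coreLettersOf` ONCE BY NAME
at `Op := OpDatum (SpeciesRec …)`, `A := L.A`): for `‖sμ‖ ≤ μ₀ < μ₁` the source derivative at `sμ` is `≤ 2·(e·ν·c₁·K₀²·A′·e^{−r₁ d(X₀)})∕(μ₁ − μ₀)`.
[folklore] -/
theorem muDeriv_locE_le_slotsOfRecord_act {W : Set (ℕ → ℝ)}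
    {ctr : ℕ → (ℕ → ℝ) → D.carriers.BgB → OpDatum (SpeciesRec D o T ι' Ω 𝒴) × B13HistM P} {ROp RHist R' : ℕ → ℝ}
    {β₀ ϑ d₀ γ : D.carriers.Dom → InnerLabel D.carriers.Dom (Bnd D.toTwoRuns) → ℝ}
    (hroom : ∀ k, ROp k < R' k) (hR' : ∀ k, 0 ≤ R' k)
    (hbase : ∀ Z j ii jj, Measurable fun a' => (L.A Z j).base a' ii jj)
    (hrdm : ∀ Z j ii jj (o' : OpDatum (SpeciesRec D o T ι' Ω 𝒴)), Measurable fun a' => (L.A Z j).rd a' ii jj o')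
    (hβ₀ : ∀ Z j, 0 ≤ β₀ Z j) (hd₀ : ∀ Z j, 0 < d₀ Z j)
    (hrd : ∀ Z j a' ii jj, ‖(L.A Z j).rd a' ii jj‖ ≤ ϑ Z j)
    (hctr : ∀ k, ∀ g ∈ W, ∀ (U : D.carriers.BgB) (Z : D.carriers.Dom) (j : InnerLabel D.carriers.Dom (Bnd D.toTwoRuns))
      (a' : (Jc Z j ⊕ 𝒵 Z j) → ℝ × ℝ),
      (∀ ii jj, ‖linForm (L.A Z j).base (L.A Z j).rd (ctr k g U).1 a' ii jj‖ ≤ β₀ Z j) ∧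
      ((linForm (L.A Z j).base (L.A Z j).rd (ctr k g U).1 a').det).im = 0 ∧ d₀ Z j ≤ ((linForm (L.A Z j).base (L.A Z j).rd (ctr k g U).1 a').det).re ∧
      (∀ x : mI Z j → ℂ, γ Z j * nsq x ≤ (star x ⬝ᵥ (linForm (L.A Z j).base (L.A Z j).rd (ctr k g U).1 a' *ᵥ x)).re))
    (hbud : ∀ k Z j, detBudget (Fintype.card (mI Z j)) (β₀ Z j) (ϑ Z j) (R' k) < d₀ Z j)
    (hmq : ∀ k Z j, Fintype.card (mI Z j) * ϑ Z j * R' k < γ Z j)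
    {k : ℕ} {g : ℕ → ℝ} (hg : g ∈ W) {U : D.carriers.BgB} {op : OpDatum (SpeciesRec D o T ι' Ω 𝒴)} {h₀ v : B13HistM P} {μ₁ : ℝ}
    (hO : ‖op - (ctr k g U).1‖ ≤ ROp k) (hH : ‖h₀ - (ctr k g U).2‖ + μ₁ * ‖v‖ ≤ RHist k)
    {emb : 𝔇.Dom → D.carriers.Dom} (hscale : ∀ Z, D.carriers.scale (emb Z) = k)
    (terms : 𝔇.Dom → Finset (D.carriers.Dom × InnerLabel D.carriers.Dom (Bnd D.toTwoRuns)))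
    {A' R r₁ b₅ μ₀ : ℝ} {X₀ : 𝔇.Dom} {sμ : ℂ} (hA : 0 ≤ A') (hr₁ : 0 ≤ r₁) (hb : r₁ * 5 ≤ b₅)
    (hrate : r₁ + 2 * Ge.κ₀ + 2 ≤ R) (hsmall : A' * Real.exp (b₅ + 1) * Ge.K₀ * Ge.ν * Ge.c₁ ≤ 1)
    (hM3 : ∀ Z, Ge.cubes Z ⊆ Ge.cubes X₀ →
      ∑ p ∈ terms Z, (coreOf P (OpDatum (SpeciesRec D o T ι' Ω 𝒴)) 𝒵 dom Jc V
            (coreLettersOf D P (OpDatum (SpeciesRec D o T ι' Ω 𝒴)) 𝒵 dom Jc V mI L.A) p.1 p.2).lam.real univ *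
          ((coreOf P (OpDatum (SpeciesRec D o T ι' Ω 𝒴)) 𝒵 dom Jc V
            (coreLettersOf D P (OpDatum (SpeciesRec D o T ι' Ω 𝒴)) 𝒵 dom Jc V mI L.A) p.1 p.2).wB *
              (gaussC (mI p.1 p.2) * Real.sqrt (max 1 ((Fintype.card (mI p.1 p.2)).factorial *
                β₀ p.1 p.2 ^ Fintype.card (mI p.1 p.2) + d₀ p.1 p.2))) * Real.exp 0) *
          (Real.pi / ((γ p.1 p.2 - Fintype.card (mI p.1 p.2) * ϑ p.1 p.2 * R' k) / 2 / 2)) ^ (Module.finrank ℝ (V p.1 p.2) / 2 : ℝ) *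
        Real.exp ((coreOf P (OpDatum (SpeciesRec D o T ι' Ω 𝒴)) 𝒵 dom Jc V
            (coreLettersOf D P (OpDatum (SpeciesRec D o T ι' Ω 𝒴)) 𝒵 dom Jc V mI L.A) p.1 p.2).N₁ * (‖h₀‖ + μ₁ * ‖v‖)) ≤
        A' * Real.exp (-(R * 𝔇.dj Z)))
    (h01 : μ₀ < μ₁) (hμ : ‖sμ‖ ≤ μ₀) :
    ‖deriv (fun σ => locE Ge.ι Ge.cubes (fun Z => ∑ p ∈ terms Z, (slotsOfRecord D ι c a s P 𝒵 dom Jc V mI L).act p.1 p.2 op (h₀ + σ • v))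
        (Ge.cubes X₀)) sμ‖ ≤
      2 * (Real.exp 1 * Ge.ν * Ge.c₁ * Ge.K₀ ^ 2 * A' * Real.exp (-(r₁ * 𝔇.dj X₀))) / (μ₁ - μ₀) := by
  rw [slotsOfRecord_act]
  exact muDeriv_locE_le_of_coreLettersOf D P (OpDatum (SpeciesRec D o T ι' Ω 𝒴)) 𝒵 dom Jc V mI 𝔇 Ge L.A hroom hR' hbase hrdm hβ₀ hd₀ hrd hctr
    hbud hmq hg hO hH hscale terms hA hr₁ hb hrate hsmall hM3 h01 hμ

/-! ## §3 THE JOINT (OPERATOR DATUM, SOURCE) END AT THE ACTIVITY SLOT OF RECORD -/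

open Classical in
/-- **JOINT HOLOMORPHY IN (OPERATOR DATUM, SOURCE) + THE (2.41) ENVELOPE OF THE DRESSED OUTPUT OF THE ACTIVITY SLOT OF RECORD** (kernel;
S46 §3 `analytic_and_bounded_locE_opSource_of_coreLettersOf` ONCE BY NAME at `Op := OpDatum (SpeciesRec …)`, `A := L.A`): binders = §2's WITHOUT
`op` ∕ `hO`; `(op, σ) ↦ E[Σ (slotsOfRecord …).act p.1 p.2 op (h₀ + σ • v)](X₀)` is complex differentiable on `ball (ctr k g U).1 (ROp k) ×ˢ
ball 0 μ₁` and bounded there by `e·ν·c₁·K₀²·A′·e^{−r₁ d(X₀)}` — S30 §1's operator-HOLOMORPHY clauses load-bearing, now for the (2.14) slot of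
record as a function of ITS operator datum `OpDatum (SpeciesRec …)`. [folklore] -/
theorem analytic_and_bounded_locE_opSource_slotsOfRecord_act {W : Set (ℕ → ℝ)}
    {ctr : ℕ → (ℕ → ℝ) → D.carriers.BgB → OpDatum (SpeciesRec D o T ι' Ω 𝒴) × B13HistM P} {ROp RHist R' : ℕ → ℝ}
    {β₀ ϑ d₀ γ : D.carriers.Dom → InnerLabel D.carriers.Dom (Bnd D.toTwoRuns) → ℝ}
    (hroom : ∀ k, ROp k < R' k) (hR' : ∀ k, 0 ≤ R' k)
    (hbase : ∀ Z j ii jj, Measurable fun a' => (L.A Z j).base a' ii jj)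
    (hrdm : ∀ Z j ii jj (o' : OpDatum (SpeciesRec D o T ι' Ω 𝒴)), Measurable fun a' => (L.A Z j).rd a' ii jj o')
    (hβ₀ : ∀ Z j, 0 ≤ β₀ Z j) (hd₀ : ∀ Z j, 0 < d₀ Z j)
    (hrd : ∀ Z j a' ii jj, ‖(L.A Z j).rd a' ii jj‖ ≤ ϑ Z j)
    (hctr : ∀ k, ∀ g ∈ W, ∀ (U : D.carriers.BgB) (Z : D.carriers.Dom) (j : InnerLabel D.carriers.Dom (Bnd D.toTwoRuns))
      (a' : (Jc Z j ⊕ 𝒵 Z j) → ℝ × ℝ),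
      (∀ ii jj, ‖linForm (L.A Z j).base (L.A Z j).rd (ctr k g U).1 a' ii jj‖ ≤ β₀ Z j) ∧
      ((linForm (L.A Z j).base (L.A Z j).rd (ctr k g U).1 a').det).im = 0 ∧ d₀ Z j ≤ ((linForm (L.A Z j).base (L.A Z j).rd (ctr k g U).1 a').det).re ∧
      (∀ x : mI Z j → ℂ, γ Z j * nsq x ≤ (star x ⬝ᵥ (linForm (L.A Z j).base (L.A Z j).rd (ctr k g U).1 a' *ᵥ x)).re))
    (hbud : ∀ k Z j, detBudget (Fintype.card (mI Z j)) (β₀ Z j) (ϑ Z j) (R' k) < d₀ Z j)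
    (hmq : ∀ k Z j, Fintype.card (mI Z j) * ϑ Z j * R' k < γ Z j)
    {k : ℕ} {g : ℕ → ℝ} (hg : g ∈ W) {U : D.carriers.BgB} {h₀ v : B13HistM P} {μ₁ : ℝ}
    (hH : ‖h₀ - (ctr k g U).2‖ + μ₁ * ‖v‖ ≤ RHist k)
    {emb : 𝔇.Dom → D.carriers.Dom} (hscale : ∀ Z, D.carriers.scale (emb Z) = k)
    (terms : 𝔇.Dom → Finset (D.carriers.Dom × InnerLabel D.carriers.Dom (Bnd D.toTwoRuns)))
    {A' R r₁ b₅ : ℝ} {X₀ : 𝔇.Dom} (hA : 0 ≤ A') (hr₁ : 0 ≤ r₁) (hb : r₁ * 5 ≤ b₅)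
    (hrate : r₁ + 2 * Ge.κ₀ + 2 ≤ R) (hsmall : A' * Real.exp (b₅ + 1) * Ge.K₀ * Ge.ν * Ge.c₁ ≤ 1)
    (hM3 : ∀ Z, Ge.cubes Z ⊆ Ge.cubes X₀ →
      ∑ p ∈ terms Z, (coreOf P (OpDatum (SpeciesRec D o T ι' Ω 𝒴)) 𝒵 dom Jc V
            (coreLettersOf D P (OpDatum (SpeciesRec D o T ι' Ω 𝒴)) 𝒵 dom Jc V mI L.A) p.1 p.2).lam.real univ *
          ((coreOf P (OpDatum (SpeciesRec D o T ι' Ω 𝒴)) 𝒵 dom Jc V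
            (coreLettersOf D P (OpDatum (SpeciesRec D o T ι' Ω 𝒴)) 𝒵 dom Jc V mI L.A) p.1 p.2).wB *
              (gaussC (mI p.1 p.2) * Real.sqrt (max 1 ((Fintype.card (mI p.1 p.2)).factorial *
                β₀ p.1 p.2 ^ Fintype.card (mI p.1 p.2) + d₀ p.1 p.2))) * Real.exp 0) *
          (Real.pi / ((γ p.1 p.2 - Fintype.card (mI p.1 p.2) * ϑ p.1 p.2 * R' k) / 2 / 2)) ^ (Module.finrank ℝ (V p.1 p.2) / 2 : ℝ) *
        Real.exp ((coreOf P (OpDatum (SpeciesRec D o T ι' Ω 𝒴)) 𝒵 dom Jc V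
            (coreLettersOf D P (OpDatum (SpeciesRec D o T ι' Ω 𝒴)) 𝒵 dom Jc V mI L.A) p.1 p.2).N₁ * (‖h₀‖ + μ₁ * ‖v‖)) ≤
        A' * Real.exp (-(R * 𝔇.dj Z))) :
    DifferentiableOn ℂ (fun z : OpDatum (SpeciesRec D o T ι' Ω 𝒴) × ℂ => locE Ge.ι Ge.cubes (fun Z => ∑ p ∈ terms Z,
        (slotsOfRecord D ι c a s P 𝒵 dom Jc V mI L).act p.1 p.2 z.1 (h₀ + z.2 • v)) (Ge.cubes X₀))
        (ball (ctr k g U).1 (ROp k) ×ˢ ball (0 : ℂ) μ₁) ∧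
      ∀ z ∈ ball (ctr k g U).1 (ROp k) ×ˢ ball (0 : ℂ) μ₁, ‖locE Ge.ι Ge.cubes (fun Z => ∑ p ∈ terms Z,
          (slotsOfRecord D ι c a s P 𝒵 dom Jc V mI L).act p.1 p.2 z.1 (h₀ + z.2 • v)) (Ge.cubes X₀)‖ ≤
        Real.exp 1 * Ge.ν * Ge.c₁ * Ge.K₀ ^ 2 * A' * Real.exp (-(r₁ * 𝔇.dj X₀)) := by
  rw [slotsOfRecord_act]
  exact analytic_and_bounded_locE_opSource_of_coreLettersOf D P (OpDatum (SpeciesRec D o T ι' Ω 𝒴)) 𝒵 dom Jc V mI 𝔇 Ge L.A hroom hR' hbase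
    hrdm hβ₀ hd₀ hrd hctr hbud hmq hg hH hscale terms hA hr₁ hb hrate hsmall hM3

end SlotsOfRecord

end Summit.QuantumFields.BalabanUV.T4Continuum.NE1p.DressedSourceAnalyticSlotsOfRecord

end
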